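import Summits.CriticalPhenomena.PercolationContinuityZ3.Theorems.PercNearOneGluingNoHeavyLowerTailSahiCombTriWShell

/-!
# `TRI_W(2)` reduces to ONE single-copy nested-chain rank statement (GEN♯2)

Sub-problem `PercolationContinuityZ3`, route `PercNearOneGluing_NoHeavy`, line (A1)/LF-UP, target
`FiveUpSet.TriWIneq` (`…SahiCombTriWGeneral`) for index cubes with two points (`a = |E₁₂| = 2`).

By the Kleitman–shell normal form (`triW_eq_shell`), `triW P F G = kleitmanPart + 2·Σ_{e∈P} c(e) − Σ_{e∈refl P} c(e)` with the
shell weight `c = shellWeight F G ≥ 0`.  For `#β = 2` (index cube `{∅, {a}, {b}, univ}`) we isolate the statement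

  (GEN♯2)  `Σ_{e ∈ refl P} c(e) ≤ Σ_{e ∈ P} c(e) + #(P ∩ (F univ ∖ (F{a} ∪ F{b})) ∩ ((G{a} ∪ G{b}) ∖ G ∅)) + kleitmanPart P F G`

(`ChainTwoIneq`, CONJECTURE — census-clean: 0 violations on 2.9·10⁷ random monotone pairs on cubes of dimension ≤ 5, many equalities;
memo FROM-prim-masterthm-p5-g16-FOUR-CHAIN-RANK §3) and prove `ChainTwoIneq → 0 ≤ triW P F G` for `#β = 2` (`triW_nonneg_of_chainTwoIneq`):
the extra block `(F univ ∖ (F{a} ∪ F{b})) ∩ ((G{a} ∪ G{b}) ∖ G ∅)` lies in the shell with weight `c = 1` (`one_le_shellWeight`), so it is paid by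
the second copy of `Σ_{e∈P} c(e)`.

WHY THIS FORM: in Hall/rank language (GEN♯2) says that the token rows {shell tokens (with multiplicity `c∘r`), the eight tilted Kleitman
demand classes `F_x ∩ r G_{xᶜ}`, `G_x ∩ r F_{xᶜ}`} are independent inside the columns of the NESTED chain of up-sets
`F₁G₁ ⊇ F₀G₁ ∪ F₁J_G ⊇ J_FM_G ∪ M_FJ_G ⊇ J_FG₀ ∪ F₀J_G ∪ M_FM_G ⊇ M_FM_G ⊇ M_FG₀ ∪ F₀M_G ⊇ F₀G₀ ⊇ F₀G₀`
(`M = F{a} ∩ F{b}`, `J = F{a} ∪ F{b}`): ONE copy, nested supplies — exactly the shape in which the `a = 1` case (RANK-Z,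
`…SahiCombFiveUpSetRank`) and the anti-nested four-chain lemma (`…SahiCombFourChainRank`) were provable; the two-copy (MU)/(S-R) forms are avoided.

HONEST LABEL: a conditional reduction (the bridge is proved; `ChainTwoIneq` is OPEN, an obligation of this theory, never a fact). [this work]
-/

namespace Summit.CriticalPhenomena.PercolationContinuityZ3.Theorems

namespace FiveUpSet

open Finset LatticeFiveUpSet

variable {β γ : Type} [DecidableEq β] [Fintype β] [DecidableEq γ] [Fintype γ]

/-- The GEN♯2 slack for a two-point index cube `{∅,{a},{b},univ}`:
`Σ_{e∈P} c(e) + #(P ∩ (F univ ∖ (F{a} ∪ F{b})) ∩ ((G{a} ∪ G{b}) ∖ G ∅)) + kleitmanPart P F G − Σ_{e∈refl P} c(e)`. [this work] -/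
def chainTwo (a b : β) (P : Finset (Finset γ)) (F G : Finset β → Finset (Finset γ)) : ℤ :=
  (∑ e ∈ P, shellWeight F G e) + (((P ∩ (F univ \ (F {a} ∪ F {b})) ∩ ((G {a} ∪ G {b}) \ G ∅)).card : ℤ))
    + kleitmanPart P F G - ∑ e ∈ refl P, shellWeight F G e

/-- **(GEN♯2)** (CONJECTURE, census-clean; an obligation of our theory, never a fact): for every finite cube, every two-point index cube
`univ = {a, b}`, all up-sets `P` and all monotone families `F, G` of up-sets, `0 ≤ chainTwo a b P F G`, i.e.
`Σ_{e∈refl P} c(e) ≤ Σ_{e∈P} c(e) + #(P ∩ (F univ ∖ (F{a} ∪ F{b})) ∩ ((G{a} ∪ G{b}) ∖ G ∅)) + kleitmanPart P F G`.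
Its Hall form has ONE copy of each demand and a NESTED supply chain (module docstring).  0 violations on 2.9·10⁷ sampled instances
(cubes of dimension 3, 4, 5; memo FROM-prim-masterthm-p5-g16-FOUR-CHAIN-RANK §3). OPEN. [this work] -/
@[conjecture] def ChainTwoIneq : Prop :=
  ∀ (β γ : Type) [DecidableEq β] [Fintype β] [DecidableEq γ] [Fintype γ] (a b : β)
    (P : Finset (Finset γ)) (F G : Finset β → Finset (Finset γ)),
    a ≠ b → (univ : Finset β) = {a, b} →
    IsUpperSet (P : Set (Finset γ)) → (∀ x, IsUpperSet (F x : Set (Finset γ))) → (∀ x, IsUpperSet (G x : Set (Finset γ))) →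
    Monotone F → Monotone G → 0 ≤ chainTwo a b P F G

omit [Fintype γ] in
/-- On the block `(F univ ∖ (F{a} ∪ F{b})) ∩ ((G{a} ∪ G{b}) ∖ G ∅)` the shell weight is at least `1`: the index profile of such a point under `F`
is `{univ}`, and `univ` lies in the `G`-profile but not in its antipodal image. [this work] -/
theorem one_le_shellWeight {a b : β} (hu : (univ : Finset β) = {a, b}) {F G : Finset β → Finset (Finset γ)}
    (hFm : Monotone F) (hGm : Monotone G) {e : Finset γ}
    (h1 : e ∈ F univ) (ha : e ∉ F {a}) (hb : e ∉ F {b}) (hG : e ∈ G {a} ∪ G {b}) (h0 : e ∉ G ∅) :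
    1 ≤ shellWeight F G e := by
  unfold shellWeight
  have hGu : e ∈ G univ := by
    rcases mem_union.mp hG with h | h
    · exact hGm (subset_univ _) h
    · exact hGm (subset_univ _) h
  have hpos : 1 ≤ (idxSet F e ∩ idxSet G e).card := by
    rw [Nat.one_le_iff_ne_zero, Ne, card_eq_zero, ← Ne, ← nonempty_iff_ne_empty]
    exact ⟨univ, by rw [mem_inter, mem_idxSet, mem_idxSet]; exact ⟨h1, hGu⟩⟩
  have hzero : idxSet F e ∩ refl (idxSet G e) = ∅ := by
    refine eq_empty_iff_forall_notMem.mpr ?_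
    intro x hx
    rw [mem_inter, mem_idxSet, mem_refl_idxSet] at hx
    obtain ⟨hxF, hxG⟩ := hx
    by_cases hxa : a ∈ x
    · by_cases hxb : b ∈ x
      · -- `x = univ`, so `xᶜ = ∅`
        have hxu : x = univ := by
          rw [hu]; ext y; constructor
          · intro hy; have := mem_univ y; rw [hu] at this; exact this
          · intro hy; rcases mem_insert.mp hy with rfl | hy
            · exact hxa
            · rw [mem_singleton] at hy; subst hy; exact hxb
        rw [hxu, compl_univ] at hxG
        exact h0 hxG
      · -- `x ⊆ {a}`
        have hxs : x ⊆ {a} := by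
          intro y hy
          have hyu := mem_univ y; rw [hu, mem_insert, mem_singleton] at hyu
          rcases hyu with rfl | rfl
          · exact mem_singleton_self _
          · exact absurd hy hxb
        exact ha (hFm hxs hxF)
    · -- `x ⊆ {b}`
      have hxs : x ⊆ {b} := by
        intro y hy
        have hyu := mem_univ y; rw [hu, mem_insert, mem_singleton] at hyu
        rcases hyu with rfl | rfl
        · exact absurd hy hxa
        · exact mem_singleton_self _
      exact hb (hFm hxs hxF)
  rw [hzero, card_empty]
  omega

omit [Fintype γ] in
/-- The extra block of (GEN♯2) is paid by one copy of the shell sum: `#(P ∩ (F univ ∖ (F{a} ∪ F{b})) ∩ ((G{a} ∪ G{b}) ∖ G ∅)) ≤ Σ_{e∈P} c(e)`. [this work] -/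
theorem card_block_le_sum_shellWeight {a b : β} (hu : (univ : Finset β) = {a, b}) (P : Finset (Finset γ))
    {F G : Finset β → Finset (Finset γ)} (hFm : Monotone F) (hGm : Monotone G) :
    (((P ∩ (F univ \ (F {a} ∪ F {b})) ∩ ((G {a} ∪ G {b}) \ G ∅)).card : ℤ)) ≤ ∑ e ∈ P, shellWeight F G e := by
  set Y := P ∩ (F univ \ (F {a} ∪ F {b})) ∩ ((G {a} ∪ G {b}) \ G ∅) with hY
  have hYP : Y ⊆ P := (inter_subset_left).trans inter_subset_left
  calc ((Y.card : ℤ)) = ∑ e ∈ Y, (1 : ℤ) := by simp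
    _ ≤ ∑ e ∈ Y, shellWeight F G e := by
        refine sum_le_sum fun e he => ?_
        rw [hY, mem_inter, mem_inter, mem_sdiff, mem_sdiff, mem_union] at he
        obtain ⟨⟨_, h1, hab⟩, hG, h0⟩ := he
        exact one_le_shellWeight hu hFm hGm h1 (fun h => hab (Or.inl h)) (fun h => hab (Or.inr h)) hG h0
    _ ≤ ∑ e ∈ P, shellWeight F G e :=
        sum_le_sum_of_subset_of_nonneg hYP fun e _ _ => shellWeight_nonneg hFm hGm e

/-- **(GEN♯2) ⟹ `TRI_W(2) ≥ 0`**: if `ChainTwoIneq` holds then `0 ≤ triW P F G` for every two-point index cube, every up-set `P` and all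
monotone families `F, G` of up-sets — by the Kleitman–shell normal form `triW = kleitmanPart + 2·Σ_P c − Σ_{refl P} c` and
`card_block_le_sum_shellWeight`. [this work] -/
theorem triW_nonneg_of_chainTwoIneq (h : ChainTwoIneq) {a b : β} (hab : a ≠ b) (hu : (univ : Finset β) = {a, b})
    (P : Finset (Finset γ)) (F G : Finset β → Finset (Finset γ))
    (hP : IsUpperSet (P : Set (Finset γ))) (hF : ∀ x, IsUpperSet (F x : Set (Finset γ)))
    (hG : ∀ x, IsUpperSet (G x : Set (Finset γ))) (hFm : Monotone F) (hGm : Monotone G) :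
    0 ≤ triW P F G := by
  rw [triW_eq_shell]
  have hc := h β γ a b P F G hab hu hP hF hG hFm hGm
  unfold chainTwo at hc
  have hY := card_block_le_sum_shellWeight hu P hFm hGm
  linarith

end FiveUpSet

end Summit.CriticalPhenomena.PercolationContinuityZ3.Theorems
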